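import Literature.Computability.AlgebraicComplexity.AndrewsForbes2022Applications
import Literature.Computability.AlgebraicComplexity.DeterminantalIdealSFT

/-!
# Andrews–Forbes 2022, Lemma 2.10 — the instance over `ℂ`

`AndrewsForbes2022_lemma_2_10_complex`: for `r ≥ 1` and all `n, m`,
`f(𝒢_{n,m,r-1}(Y,Z)) = 0 ↔ f ∈ I^det_{n,m,r}` over `ℂ`, in the vocabulary of
`AndrewsForbes2022Applications.lean` (`matrixGenerator`, `detIdeal`).  Proof: the generator map
`f ↦ f(𝒢_{n,m,t})` is literally the tree's `genericProductHom (Fin n) (Fin m) F t`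
(`bind₁_matrixGenerator_eq_genericProductHom`, `rfl`), whose kernel over `ℂ` is the determinantal ideal
by the Second Fundamental Theorem `ker_genericProductHom_eq_determinantalIdeal`
(`DeterminantalIdealSFT.lean`, Goodman–Wallach Thm. 12.2.12), and `determinantalIdeal_eq_detIdeal`.
The named fact `AndrewsForbes2022_lemma_2_10` (EVERY field, p0013:L71) is NOT discharged: its `⇐`
half holds over every field (`bind₁_matrixGenerator_eq_zero_of_mem_detIdeal`, same file B), its `⇒`
half needs the SFT over an arbitrary field, which the tree has over `ℂ` only.  No new facts.

Honest framing: a special case of a typed literature statement; VP ≠ VNP is NOT proved.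

## References
* [AndrewsForbes2022] R. Andrews, M. A. Forbes, STOC 2022, arXiv:2112.00792 — Construction 2.8,
  Lemma 2.10 (p0013).
* [GoodmanWallachGTM255] R. Goodman, N. Wallach, *Symmetry, Representations, and Invariants*,
  GTM 255, Thm. 12.2.12 — as formalised in `DeterminantalIdealSFT.lean`.
-/

noncomputable section

open MvPolynomial

namespace Literature.Computability.AlgebraicComplexity

/-- `𝒢_{n,m,t}` IS the generic-product substitution of the tree's Second Fundamental Theorem file
(`genericProductHom (Fin n) (Fin m) F t`): same seed variables `(Fin n × Fin t) ⊕ (Fin t × Fin m)`,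
same quadratic forms `Σ_k y_{ik} z_{kj}`. [cite: AndrewsForbes2022, Construction 2.8] -/
theorem bind₁_matrixGenerator_eq_genericProductHom (F : Type) [Field F] (n m t : ℕ)
    (f : MvPolynomial (Fin n × Fin m) F) :
    MvPolynomial.bind₁ (matrixGenerator F n m t) f = genericProductHom (Fin n) (Fin m) F t f := rfl

/-- **Lemma 2.10 over `ℂ`** (the instance the tree can certify today): for `r ≥ 1` and EVERY `n, m`
(the printed `r ≤ min(n,m)` is not needed), `f(𝒢_{n,m,r-1}(Y,Z)) = 0 ↔ f ∈ I^det_{n,m,r}` — by the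
tree's Second Fundamental Theorem `ker_genericProductHom_eq_determinantalIdeal` (Goodman–Wallach
Thm. 12.2.12, over `ℂ`). The named fact `AndrewsForbes2022_lemma_2_10` (every field) stays open: its
`⇐` half is `bind₁_matrixGenerator_eq_zero_of_mem_detIdeal` (every field), its `⇒` half needs the SFT
over an arbitrary field. [cite: AndrewsForbes2022, Lemma 2.10] -/
theorem AndrewsForbes2022_lemma_2_10_complex (n m r : ℕ) (hr : 1 ≤ r)
    (f : MvPolynomial (Fin n × Fin m) ℂ) :
    MvPolynomial.bind₁ (matrixGenerator ℂ n m (r - 1)) f = 0 ↔ f ∈ detIdeal ℂ n m r := by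
  obtain ⟨t, rfl⟩ : ∃ t, r = t + 1 := ⟨r - 1, by omega⟩
  rw [Nat.add_sub_cancel, ← determinantalIdeal_eq_detIdeal, ← ker_genericProductHom_eq_determinantalIdeal,
    RingHom.mem_ker, bind₁_matrixGenerator_eq_genericProductHom]

end Literature.Computability.AlgebraicComplexity
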